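import Mathlib.Analysis.InnerProductSpace.Basic
import Mathlib.Analysis.SpecificLimits.Basic
import Mathlib.MeasureTheory.Integral.IntervalIntegral.Basic
import HarnessLib

/-!
# Symmetric semigroups on a pre-Hilbert space: contraction and convergence

Trunk **T-AQFT** (support file for the Osterwalder–Schrader reconstruction step behind
`Literature.MathematicalPhysics.QuantumLattice.OSAxiomsMeasure`), families `constructive-qft`,
`crit-ising`.

The abstract (Hilbert-space) half of Glimm–Jaffe's reconstruction of the transfer semigroup
`e^{-tH}` from a reflection-positive, time-translation-invariant measure (Glimm–Jaffe, *Quantum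
Physics* (2nd ed. 1987), Thm 6.1.3, pp. 88–89) and of the "uniqueness of the vacuum ⇒
clustering" step (§19.7, p. 314–315), in elementary form and *without* completing or quotienting:

* `Literature.MathematicalPhysics.QuantumLattice.norm_semigroup_le` — **contraction** (GJ Thm 6.1.3, property (iii)): if linear maps
  `S t`, `t ≥ 0`, on a pre-inner-product space satisfy the semigroup law, are symmetric
  (`⟪S t v, w⟫ = ⟪v, S t w⟫`) and each orbit `t ↦ ‖S t v‖` is bounded, then `‖S t v‖ ≤ ‖v‖`.
  Proof exactly as printed: iterating Schwarz, `‖S t v‖ ≤ ‖v‖^{1-2⁻ⁿ} ‖S (2ⁿt) v‖^{2⁻ⁿ}`, and the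
  last factor is bounded (`le_of_sq_le_mul_succ` is the real-sequence lemma behind `n → ∞`).
* `Literature.MathematicalPhysics.QuantumLattice.exists_tendsto_inner_semigroup` — **convergence**: under the same hypotheses every
  matrix element `t ↦ ⟪v, S t w⟫` converges as `t → +∞`. (By contraction `t ↦ ‖S t w‖` is
  antitone, hence convergent; `‖S t w - S s w‖² = ‖S t w‖² + ‖S s w‖² - 2 ‖S ((t+s)/2) w‖² → 0`,
  so `S t w` is Cauchy in the seminorm and `⟪v, S t w⟩` is Cauchy in `𝕜`.) In the spectral
  language of GJ p. 315 this is `st-lim e^{-tH} = P_inv`; the elementary argument avoids the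
  spectral theorem, which Mathlib lacks for unbounded self-adjoint operators.
* `Literature.MathematicalPhysics.QuantumLattice.tendsto_inv_smul_intervalIntegral` — Cesàro means `T⁻¹ ∫₀ᵀ c` of a locally
  integrable function with `c t → L` converge to `L` (used to identify the limit above with the
  ergodic average (6.1.10)).

## Sources

* J. Glimm, A. Jaffe, *Quantum Physics: a functional integral point of view* (2nd ed. 1987),
  Thm 6.1.3 (pp. 88–89) and Thm 19.7.1 with the Remark following it (pp. 314–315).
  [GlimmJaffeQP1987]

## Mathlib

Used: `InnerProductSpace` over a `SeminormedAddCommGroup` (pre-Hilbert spaces, so no quotient by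
null vectors is needed), `norm_inner_le_norm`, `norm_sub_sq`, `tendsto_atTop_ciInf`,
`Metric.cauchySeq_iff`, `cauchySeq_tendsto_of_complete`, `intervalIntegral`.
Searched and absent at the pin: mean ergodic / convergence statements for self-adjoint contraction
semigroups (`ContractionSemigroup`, `selfAdjoint.*semigroup`), Cesàro convergence of interval
averages (`cesaro` only for sequences: `Filter.Tendsto.cesaro*` absent as well).
-/

open scoped InnerProductSpace Topology
open Filter Set

namespace Literature.MathematicalPhysics.QuantumLattice

/-! ### A real-sequence lemma -/

/-- If `aₙ ≤ M` and `aₙ² ≤ c · aₙ₊₁` for all `n` (with `c ≥ 0`), then `a₀ ≤ c`. This is the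
`n → ∞` step in Glimm–Jaffe's proof of Thm 6.1.3 (iii): otherwise `aₙ ≥ c (a₀/c)^{2ⁿ} → ∞`.
[cite: GlimmJaffeQP1987, Thm 6.1.3 (proof, property iii)] -/
theorem le_of_sq_le_mul_succ {a : ℕ → ℝ} {c M : ℝ} (hc : 0 ≤ c)
    (hbdd : ∀ n, a n ≤ M) (hsq : ∀ n, a n ^ 2 ≤ c * a (n + 1)) : a 0 ≤ c := by
  by_contra h
  push Not at h
  have ha0 : 0 < a 0 := hc.trans_lt h
  have hcpos : 0 < c := by
    rcases hc.lt_or_eq with hc' | hc'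
    · exact hc'
    · exfalso
      have := hsq 0
      rw [← hc', zero_mul] at this
      nlinarith
  set r := a 0 / c with hr
  have hr1 : 1 < r := by rwa [hr, one_lt_div hcpos]
  have hclaim : ∀ n : ℕ, c * r ^ (2 ^ n) ≤ a n := by
    intro n
    induction n with
    | zero => rw [pow_zero, pow_one, hr, mul_div_cancel₀ _ hcpos.ne']
    | succ n ih =>
      have h0 : 0 ≤ c * r ^ (2 ^ n) := by positivity
      have h1 : (c * r ^ (2 ^ n)) ^ 2 ≤ a n ^ 2 := pow_le_pow_left₀ h0 ih 2
      have h2 : (c * r ^ (2 ^ n)) ^ 2 = c * (c * r ^ (2 ^ (n + 1))) := by ring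
      have h3 : c * (c * r ^ (2 ^ (n + 1))) ≤ c * a (n + 1) := by
        rw [← h2]; exact h1.trans (hsq n)
      exact le_of_mul_le_mul_left h3 hcpos
  obtain ⟨n, hn⟩ := pow_unbounded_of_one_lt (M / c) hr1
  have hn' : r ^ n ≤ r ^ (2 ^ n) := pow_le_pow_right₀ hr1.le (Nat.lt_two_pow_self).le
  have : M < c * r ^ (2 ^ n) := by
    rw [div_lt_iff₀ hcpos] at hn
    nlinarith
  exact absurd ((hclaim n).trans (hbdd n)) (not_le.2 this)

/-! ### Symmetric bounded semigroups on a pre-inner-product space -/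

section Semigroup

variable {𝕜 : Type*} [RCLike 𝕜]
variable {V : Type*} [SeminormedAddCommGroup V] [InnerProductSpace 𝕜 V]

/-- **Contraction property** (Glimm–Jaffe Thm 6.1.3 (iii)). Let `S t` (`t ≥ 0`) be linear maps
on a pre-inner-product space with `S (s + t) = S s ∘ S t`, symmetric (`⟪S t v, w⟫ = ⟪v, S t w⟫`)
and with bounded orbits `sup_{t ≥ 0} ‖S t v‖ < ∞`. Then each `S t` is a contraction:
`‖S t v‖ ≤ ‖v‖`. Proof as printed: `‖S t v‖² = ⟪v, S (2t) v⟫ ≤ ‖v‖ ‖S (2t) v‖`, iterate.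
[cite: GlimmJaffeQP1987, Thm 6.1.3 (iii)] -/
theorem norm_semigroup_le (S : ℝ → V →ₗ[𝕜] V)
    (hS : ∀ s t : ℝ, 0 ≤ s → 0 ≤ t → S (s + t) = S s ∘ₗ S t)
    (hsymm : ∀ t : ℝ, 0 ≤ t → ∀ v w : V, ⟪S t v, w⟫_𝕜 = ⟪v, S t w⟫_𝕜)
    (hbdd : ∀ v : V, ∃ M : ℝ, ∀ t : ℝ, 0 ≤ t → ‖S t v‖ ≤ M)
    {t : ℝ} (ht : 0 ≤ t) (v : V) : ‖S t v‖ ≤ ‖v‖ := by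
  -- basic step: `‖S s u‖² ≤ ‖u‖ ‖S (2s) u‖`
  have hstep : ∀ (s : ℝ), 0 ≤ s → ∀ u : V, ‖S s u‖ ^ 2 ≤ ‖u‖ * ‖S (2 * s) u‖ := by
    intro s hs u
    have h1 : (‖S s u‖ ^ 2 : ℝ) = RCLike.re ⟪u, S (2 * s) u⟫_𝕜 := by
      rw [← inner_self_eq_norm_sq (𝕜 := 𝕜), hsymm s hs, two_mul, hS s s hs hs,
        LinearMap.comp_apply]
    rw [h1]
    exact (RCLike.re_le_norm _).trans (norm_inner_le_norm _ _)
  obtain ⟨M, hM⟩ := hbdd v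
  let a : ℕ → ℝ := fun n => ‖S (2 ^ n * t) v‖
  have ha0 : a 0 = ‖S t v‖ := by simp [a]
  rw [← ha0]
  refine le_of_sq_le_mul_succ (norm_nonneg v) (fun n => hM _ (by positivity)) fun n => ?_
  have := hstep (2 ^ n * t) (by positivity) v
  simpa [a, pow_succ, mul_comm, mul_assoc, mul_left_comm] using this

/-- Orbits of a symmetric bounded semigroup have antitone norm: `‖S t w‖ ≤ ‖S s w‖` for
`0 ≤ s ≤ t` (from the contraction property and the semigroup law).
[cite: GlimmJaffeQP1987, Thm 6.1.3 (iii)] -/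
theorem norm_semigroup_antitone (S : ℝ → V →ₗ[𝕜] V)
    (hS : ∀ s t : ℝ, 0 ≤ s → 0 ≤ t → S (s + t) = S s ∘ₗ S t)
    (hsymm : ∀ t : ℝ, 0 ≤ t → ∀ v w : V, ⟪S t v, w⟫_𝕜 = ⟪v, S t w⟫_𝕜)
    (hbdd : ∀ v : V, ∃ M : ℝ, ∀ t : ℝ, 0 ≤ t → ‖S t v‖ ≤ M)
    (w : V) {s t : ℝ} (hs : 0 ≤ s) (hst : s ≤ t) : ‖S t w‖ ≤ ‖S s w‖ := by
  have : S t w = S (t - s) (S s w) := by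
    rw [← LinearMap.comp_apply, ← hS (t - s) s (sub_nonneg.2 hst) hs, sub_add_cancel]
  rw [this]
  exact norm_semigroup_le S hS hsymm hbdd (sub_nonneg.2 hst) _

/-- **Convergence of matrix elements** (Glimm–Jaffe §19.7, p. 315, `st-lim_{t→∞} e^{-tH}`
exists, in elementary form). For a symmetric semigroup `S t` (`t ≥ 0`) with bounded orbits on a
pre-inner-product space, every matrix element `t ↦ ⟪v, S t w⟫` converges as `t → +∞`.
Proof: `t ↦ ‖S t w‖` is antitone and bounded below, hence convergent, and
`‖S t w - S s w‖² = ‖S t w‖² + ‖S s w‖² - 2‖S((t+s)/2) w‖²`, so `S t w` is Cauchy for the seminorm;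
Schwarz then makes `⟪v, S t w⟫` Cauchy in `𝕜`. [cite: GlimmJaffeQP1987, Thm 19.7.1 (proof)] -/
theorem exists_tendsto_inner_semigroup (S : ℝ → V →ₗ[𝕜] V)
    (hS : ∀ s t : ℝ, 0 ≤ s → 0 ≤ t → S (s + t) = S s ∘ₗ S t)
    (hsymm : ∀ t : ℝ, 0 ≤ t → ∀ v w : V, ⟪S t v, w⟫_𝕜 = ⟪v, S t w⟫_𝕜)
    (hbdd : ∀ v : V, ∃ M : ℝ, ∀ t : ℝ, 0 ≤ t → ‖S t v‖ ≤ M) (v w : V) :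
    ∃ L : 𝕜, Tendsto (fun t : ℝ => ⟪v, S t w⟫_𝕜) atTop (𝓝 L) := by
  -- Step 1: `Φ t = ‖S (max t 0) w‖` is antitone and bounded below, hence converges.
  set Φ : ℝ → ℝ := fun t => ‖S (max t 0) w‖ with hΦ
  have hΦanti : Antitone Φ := fun s t hst =>
    norm_semigroup_antitone S hS hsymm hbdd w (le_max_right s 0) (max_le_max hst le_rfl)
  have hΦbdd : BddBelow (range Φ) := ⟨0, by rintro _ ⟨t, rfl⟩; exact norm_nonneg _⟩
  have hΦlim : Tendsto Φ atTop (𝓝 (⨅ t, Φ t)) := tendsto_atTop_ciInf hΦanti hΦbdd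
  set L₀ := ⨅ t, Φ t
  -- Step 2: the parallelogram-type identity.
  have hident : ∀ s t : ℝ, 0 ≤ s → 0 ≤ t →
      ‖S t w - S s w‖ ^ 2 = Φ t ^ 2 + Φ s ^ 2 - 2 * Φ ((t + s) / 2) ^ 2 := by
    intro s t hs ht
    have hm : 0 ≤ (t + s) / 2 := by positivity
    have hts : t + s = (t + s) / 2 + (t + s) / 2 := by ring
    have key : S t (S s w) = S ((t + s) / 2) (S ((t + s) / 2) w) := by
      rw [← LinearMap.comp_apply (S t) (S s) w, ← hS t s ht hs,
        ← LinearMap.comp_apply (S _) (S _) w, ← hS _ _ hm hm, ← hts]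
    have hinner : RCLike.re ⟪S t w, S s w⟫_𝕜 = Φ ((t + s) / 2) ^ 2 := by
      simp only [hΦ, max_eq_left hm]
      rw [hsymm t ht, key, ← hsymm _ hm, inner_self_eq_norm_sq]
    rw [@norm_sub_sq 𝕜, hinner]
    simp only [hΦ, max_eq_left hs, max_eq_left ht]
    ring
  -- Step 3: `S t w` is Cauchy in the seminorm.
  have hcauchy : ∀ ε : ℝ, 0 < ε → ∃ T : ℝ, 0 ≤ T ∧ ∀ s t : ℝ, T ≤ s → T ≤ t →
      ‖S t w - S s w‖ < ε := by
    intro ε hε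
    have hsq : Tendsto (fun t => Φ t ^ 2) atTop (𝓝 (L₀ ^ 2)) := hΦlim.pow 2
    have hε' : 0 < ε ^ 2 / 4 := by positivity
    obtain ⟨T, hT⟩ := (Metric.tendsto_atTop.1 hsq) (ε ^ 2 / 4) hε'
    refine ⟨max T 0, le_max_right _ _, fun s t hs ht => ?_⟩
    have hs0 : 0 ≤ s := (le_max_right T 0).trans hs
    have ht0 : 0 ≤ t := (le_max_right T 0).trans ht
    have hTs : T ≤ s := (le_max_left T 0).trans hs
    have hTt : T ≤ t := (le_max_left T 0).trans ht
    have hTm : T ≤ (t + s) / 2 := by linarith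
    have h1 := hT t hTt
    have h2 := hT s hTs
    have h3 := hT _ hTm
    rw [Real.dist_eq, abs_lt] at h1 h2 h3
    have hlt : ‖S t w - S s w‖ ^ 2 < ε ^ 2 := by
      rw [hident s t hs0 ht0]
      linarith
    exact (pow_lt_pow_iff_left₀ (norm_nonneg _) hε.le two_ne_zero).1 hlt
  -- Step 4: `⟪v, S t w⟫` is Cauchy in `𝕜`, hence converges.
  have hCauchy : CauchySeq fun t : ℝ => ⟪v, S t w⟫_𝕜 := by
    refine Metric.cauchySeq_iff.2 fun ε hε => ?_
    obtain ⟨T, -, hT⟩ := hcauchy (ε / (‖v‖ + 1)) (by positivity)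
    refine ⟨T, fun s hs t ht => ?_⟩
    rw [dist_eq_norm, ← inner_sub_right]
    calc ‖⟪v, S s w - S t w⟫_𝕜‖ ≤ ‖v‖ * ‖S s w - S t w‖ := norm_inner_le_norm _ _
      _ ≤ ‖v‖ * (ε / (‖v‖ + 1)) := by gcongr; exact (hT t s ht hs).le
      _ < ε := by
          rw [mul_div_assoc', div_lt_iff₀ (by positivity)]
          nlinarith [norm_nonneg v]
  exact cauchySeq_tendsto_of_complete hCauchy

end Semigroup

/-! ### Cesàro means of a convergent function -/

/-- If `c : ℝ → E` is interval integrable on every bounded interval and `c t → L` as `t → +∞`,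
then the Cesàro means converge: `T⁻¹ ∫₀ᵀ c(t) dt → L`. (Elementary; used to identify limits of
matrix elements with ergodic averages, Glimm–Jaffe (6.1.10) and (19.7.1).) [folklore] -/
theorem tendsto_inv_smul_intervalIntegral {E : Type*} [NormedAddCommGroup E] [NormedSpace ℝ E]
    [CompleteSpace E] {c : ℝ → E} {L : E} (hc : Tendsto c atTop (𝓝 L))
    (hint : ∀ a b : ℝ, IntervalIntegrable c MeasureTheory.volume a b) :
    Tendsto (fun T : ℝ => T⁻¹ • ∫ t in (0 : ℝ)..T, c t) atTop (𝓝 L) := by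
  refine Metric.tendsto_atTop.2 fun ε hε => ?_
  obtain ⟨t₀, ht₀⟩ := (Metric.tendsto_atTop.1 hc) (ε / 2) (half_pos hε)
  -- WLOG `t₀ ≥ 0`
  set t₁ := max t₀ 0 with ht₁
  have ht₁0 : 0 ≤ t₁ := le_max_right _ _
  have hct₁ : ∀ t, t₁ ≤ t → ‖c t - L‖ < ε / 2 := fun t ht => by
    rw [← dist_eq_norm]; exact ht₀ t ((le_max_left _ _).trans ht)
  set K := ‖∫ t in (0 : ℝ)..t₁, (c t - L)‖ with hK
  have hK0 : 0 ≤ K := norm_nonneg _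
  refine ⟨max (t₁ + 1) (2 * K / ε + 1), fun T hT => ?_⟩
  have hT₁ : t₁ + 1 ≤ T := (le_max_left _ _).trans hT
  have hTK : 2 * K / ε + 1 ≤ T := (le_max_right _ _).trans hT
  have hTpos : 0 < T := by linarith
  have hintL : ∀ a b : ℝ, IntervalIntegrable (fun _ => L) MeasureTheory.volume a b :=
    fun a b => intervalIntegrable_const
  have hsub : ∀ a b : ℝ, IntervalIntegrable (fun t => c t - L) MeasureTheory.volume a b :=
    fun a b => (hint a b).sub (hintL a b)
  -- rewrite the Cesàro mean minus `L`
  have hrew : T⁻¹ • (∫ t in (0 : ℝ)..T, c t) - L = T⁻¹ • ∫ t in (0 : ℝ)..T, (c t - L) := by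
    rw [intervalIntegral.integral_sub (hint 0 T) (hintL 0 T), intervalIntegral.integral_const,
      sub_zero, smul_sub, smul_smul, inv_mul_cancel₀ hTpos.ne', one_smul]
  rw [dist_eq_norm, hrew, ← intervalIntegral.integral_add_adjacent_intervals (hsub 0 t₁) (hsub t₁ T),
    smul_add]
  have h1 : ‖T⁻¹ • ∫ t in (0 : ℝ)..t₁, (c t - L)‖ ≤ K / T := by
    rw [norm_smul, norm_inv, Real.norm_of_nonneg hTpos.le, div_eq_inv_mul]
  have h2 : ‖T⁻¹ • ∫ t in t₁..T, (c t - L)‖ ≤ ε / 2 := by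
    rw [norm_smul, norm_inv, Real.norm_of_nonneg hTpos.le]
    have hb : ‖∫ t in t₁..T, (c t - L)‖ ≤ ε / 2 * |T - t₁| := by
      refine intervalIntegral.norm_integral_le_of_norm_le_const fun t ht => (hct₁ t ?_).le
      rw [uIoc_of_le (by linarith)] at ht
      exact ht.1.le
    rw [abs_of_nonneg (by linarith)] at hb
    calc T⁻¹ * ‖∫ t in t₁..T, (c t - L)‖ ≤ T⁻¹ * (ε / 2 * (T - t₁)) := by gcongr
      _ ≤ T⁻¹ * (ε / 2 * T) := by gcongr; linarith
      _ = ε / 2 := by field_simp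
  have h3 : K / T < ε / 2 := by
    rw [div_lt_iff₀ hTpos]
    have : 2 * K < ε * T := by
      rw [div_add_one (ne_of_gt hε), div_le_iff₀ hε] at hTK
      nlinarith
    linarith
  calc ‖(T⁻¹ • ∫ t in (0 : ℝ)..t₁, (c t - L)) + T⁻¹ • ∫ t in t₁..T, (c t - L)‖
      ≤ ‖T⁻¹ • ∫ t in (0 : ℝ)..t₁, (c t - L)‖ + ‖T⁻¹ • ∫ t in t₁..T, (c t - L)‖ := norm_add_le _ _
    _ ≤ K / T + ε / 2 := add_le_add h1 h2
    _ < ε := by linarith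

end Literature.MathematicalPhysics.QuantumLattice
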